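import Literature.MathematicalPhysics.QuantumFieldTheory.BalabanImbrieJaffe1984to88.BIJ88Eq5613Kinetic
import Literature.MathematicalPhysics.QuantumFieldTheory.BalabanImbrieJaffe1984to88.BIJ88Insertions288

/-!
# `BalabanImbrieJaffe1984to88.BIJ88Eq5613KineticSources` — T. Bałaban, J. Imbrie, A. Jaffe, *Effective action and cluster properties
of the abelian Higgs model*, Commun. Math. Phys. **114** (1988) 257–315 [BalabanImbrieJaffe1988], §5.6 p. 288 [PDF 32]: the COMPLETE
kinetic cube term of **(5.6.13)** — the kinetic site `W₁` of the bookkeeping file `BIJ88Eq5613Summary` (`W1` = phase-factor source +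
`w₁` source + order-`> n̄` Taylor remainder; no propagator, so no localization `δR`) with the two *"extremely small"* sources FED BY
NAME from the (5.4.7) leaf of row C2.Eq5.4.7 (r16's `BIJ88Sect5StatementsPart2.Ineq547` for `w₂` and for `w₁`, via p31 g10
`BIJ88Insertions288.norm_phase_sub_one_le` and r16 g8 `BIJ88RotationResidual282.abs_sum_mul_le_of_ineq547`), and the bound
*"|W₁^{(k)}(□)| ≦ e_k^{n̄−1−α}"* for it in print's currency: the `e^{−cr(e_k)}` of (5.4.7) is converted into powers of `e_k` by
`BIJ88Eq5613Summary.exp_neg_mul_rLen_le_rpow`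

statement-level skeleton of published theorems with citation tags; proofs where landed; nothing here is a claim about the Yang–Mills mass gap

PDF held: `paper:balaban1988-cmp114-bij-abelian-higgs-effective-action` (journal page = PDF page + 256); p. 288 [PDF 32], p. 287
[PDF 31], p. 282 [PDF 26] ((5.4.7)) read as images this session / in r16's renders.

CITATION HEADER (lean-in-tree rule).  Part of the lit-balaban TYPED SKELETON (HOME `run/shared/lean/pub/lit-balaban/`), PHASE-2 proof
seat p31 gen 11 (unit `lit-balaban-p31-g11`).  WHAT IS REPRODUCED: row `C2.Eq5.6.13` of `HOME/lit-balaban-r16/ROWS-C2-part2.md`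
(owner r16; flip condition (b) of ROWS-C2-part2 v2.74: *"the w₁/w₂ sources fed BY NAME from row C2.Eq5.4.7"*), p. 288 [PDF 32],
verbatim: *"The scalar fields appear with factors e^{ie_kw₂A′} before then. … We expand the phase factors as 1 + (e^{ie_kw₂A′} − 1), the
second term being extremely small. … Any term involving w₁ or w₂, and terms of higher than n̄-th order in e_k are irrelevant and will
be treated separately. … ½aL⁻²⟨ψ̃ − Q(u′_k)φ̃, ψ̃ − Q(u′_k)φ̃⟩ + … = ½aL⁻²⟨ψ − Q(ũ_{k+1})φ, ψ − Q(ũ_{k+1})φ⟩ + … + R^{(k)}(…) +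
Σ_□W₁^{(k)}(□). (5.6.13) The tildes on φ and ψ indicate the presence of the phase factors. Here W₁^{(k)}(□) is localized near □, an
r(e_k)-cube in Λ₂^{(k)}, and |W₁^{(k)}(□)| ≦ e_k^{n̄−1−α}."*; (5.6.6) p. 287 *"ũ_{k+1}ũ = ũ_{k+1}exp ie_kη[θ_kH_{k,loc}A^{(k)} + w₁A′]"*;
(5.4.7) p. 282 *"|w₂(x,b)| ≦ exp(−cr(e_k))exp(−c dist(x,b)) … and similarly for w′₁"*.

THE OBJECTS.  At an `L`-site `y`: the physical kinetic density `S_phys(y) = κ|ψ(y)P_ψ(y) − (Q(ũ_{k+1}e^{iA′}e^{iA})(φP_φ))(y)|²`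
(`kinPhys`: phase factors `P_ψ(y) = e^{ie_k(w₂A′)(y)}`, `P_φ(x) = e^{ie_k(w₂A′)(x)}`; transporters of `ũ_{k+1}ũ` = `U·e^{iA′}·e^{iA}`,
`A′(y,x) = e_kη(w₁A′)(Γ_{y,x})`, `A(y,x) = e_kη(θ_kH_{k,loc}A^{(k)})(Γ_{y,x})`), the same WITHOUT phase factors `S_w(y)` (`kinW`), the
interpolation family `S_y(e′)` of `BIJ88Eq5613Kinetic.kin`, and the kinetic site term **`W1kinTot(y) := W1 (S_phys(y)) (S_y) n̄ 0`** of
the companion bookkeeping (`δR = 0`: the kinetic term has no propagator).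

WHAT IS PROVED (0 `sorry`, standard axioms; definitions with bodies + theorems, no `Prop` facts).
* §1 the (5.4.7) feeds: `contourPhase`/`abs_contourPhase_le` and `abs_contourPhase_le_of_ineq547` (`|A′(y,x)| ≤ e_kηN_Γ·e^{−cr}S₁a` from `Ineq547` for `w₁` by name)
  (`|A′(y,x)| = |e_kηΣ_{b∈Γ}σ_b(w₁A′)(b)| ≤ e_kη·N_Γ·e^{−cr}S₁a`), `phaseFactor`/`norm_phaseFactor_sub_one_le` (`‖e^{ie_k(w₂A′)(x)} − 1‖ ≤
  2e_ke^{−cr}S₂a`, p31 g10's lemma by name).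
* §2 `kinPhys`, `kinW`, `W1kinTot`, **`W1kinTot_eq_sources`** (`= (S_phys − S_w) + (S_w − S_y(1)) + W₁,kin(y)`), `eq5613_kinTot_site`
  (`S_phys(y) = S_y(0) + R̃_y + W1kinTot(y)`), **`abs_W1kinTot_le`** (the three pieces: `|κ|δ(2+δ)ρ₀² + |κ|δ′ρ₁(2ρ₀+δ′ρ₁) +
  |κ|(2G)^{n̄+1}ρ₁ρ₀/n̄!`).
* §3 print's currency: **`abs_W1kinTot_le_scale`** (`≤ K·e_k^{n̄−1}p(e_k)^{n̄+3}` once `e^{−cr(e_k)} ≤ e_k^{n̄}`), `W1kinTotCube`,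
  `eq5613_kinTot` (the kinetic line of (5.6.13) with the PHYSICAL left side), `abs_W1kinTotCube_le_scale`, **`ineq5613_kinTot`**
  (r16's leaf `Ineq5613` for the complete kinetic cube term, `0 < e_k ≤ min(e⁻¹, e₀)`, `(log e_k⁻¹)^{r−1} ≥ n̄/c`).
HONEST SCOPE.  The lattice sums `Σ_be^{−c dist(·,b)} ≤ S`, the bound `|A′| ≤ a = c_ap(e_k)` ((5.3.1)/(5.9.4)), contour data
(`|σ| ≤ 1`, `|Γ| ≤ N_Γ`, `e_kηN_Γ ≤ c_Γe_k`) and the small-field radii enter as DISPLAYED hypotheses; the regime conditions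
`δ, δ′ ≤ 1`, `e_ke^{−cr}S₂a ≤ 1` likewise.  Imports the companions `BIJ88Eq5613Kinetic` and p31 g10 `BIJ88Insertions288`; no Summits
import; modifies nothing.  Unit `lit-balaban-p31` (literature-prover-lit-balaban-p31-g11-0), 2026-08-22.  NOT summit progress.
-/

noncomputable section

open Complex
open scoped BigOperators ComplexConjugate
open Set

namespace Literature.MathematicalPhysics.QuantumFieldTheory.BalabanImbrieJaffe1984to88.BIJ88Eq5613KineticSources

open BIJ88Sect5StatementsPart4 (covAvg)
open BIJ88TaylorSplit5614 (Rtilde Ftilde)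
open BIJ88Eq5613Summary (W1 W1_eq_sources eq5613 cubeSum cubeSum_congr norm_cubeSum_le sum_eq_sum_cubeSum
  ineq5613_of_cube_bounds absorb_logs threshold pLog_eq_rpow rLen_eq_rpow one_le_log_inv log_rpow_le_log_rpow
  log_rpow_mul_log_rpow log_rpow_pow le_one_of_le_exp_neg_one exp_neg_mul_rLen_le_rpow)
open BIJ88Eq5613Kinetic (ephase twist resid kin rho1 W1kin ephase_eq norm_ephase ephase_zero twist_zero contDiff_kin
  rho1_nonneg rho1_le_of_fieldBound norm_resid_le abs_W1kin_le abs_kin_phase_sub_le abs_kin_w1_sub_le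
  norm_ephase_one_sub_one_le kinConst kinLogPower kinConst_nonneg)
open BIJ88Sect5StatementsPart2 (Ineq547 Ineq5613)
open BIJ88Sect2Statements (pLog rLen)

/-! ## §1 The (5.4.7) feeds: sizes of the `w₁`-phases and of the phase factors -/

section Feeds

variable {Bd : Type} {α β : Type}

/-- The `w₁`-phase of one transporter of `ũ` along the contour `Γ_{y,x}` ((5.6.6): `ũ = exp ie_kη[θ_kH_{k,loc}A^{(k)} + w₁A′]`):
`A′(y,x) = e_kη·Σ_{b∈Γ_{y,x}} σ_{y,x}(b)·(w₁A′)(b)` (`σ` = orientation signs, `|σ| ≤ 1`). [cite: BalabanImbrieJaffe1988, (5.6.6) p.287] -/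
def contourPhase (ekη : ℝ) (Γ : β → α → Finset Bd) (σ : β → α → Bd → ℝ) (W : Bd → ℝ) (y : β) (x : α) : ℝ :=
  ekη * ∑ b ∈ Γ y x, σ y x b * W b

/-- kernel: **`|A′(y,x)| ≤ e_kη·N_Γ·ω`** for `|σ| ≤ 1`, `|Γ_{y,x}| ≤ N_Γ` and `|(w₁A′)(b)| ≤ ω` (then `ω = e^{−cr(e_k)}S₁a` by
`abs_contourPhase_le_of_ineq547`). [cite: BalabanImbrieJaffe1988, (5.6.6) p.287] -/
theorem abs_contourPhase_le {ekη NΓ ω : ℝ} (hekη : 0 ≤ ekη) (hω : 0 ≤ ω) (Γ : β → α → Finset Bd) (σ : β → α → Bd → ℝ)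
    (W : Bd → ℝ) {y : β} {x : α} (hσ : ∀ b ∈ Γ y x, |σ y x b| ≤ 1) (hΓ : ((Γ y x).card : ℝ) ≤ NΓ) (hW : ∀ b, |W b| ≤ ω) :
    |contourPhase ekη Γ σ W y x| ≤ ekη * NΓ * ω := by
  unfold contourPhase
  rw [abs_mul, abs_of_nonneg hekη, mul_assoc]
  refine mul_le_mul_of_nonneg_left ?_ hekη
  calc |∑ b ∈ Γ y x, σ y x b * W b| ≤ ∑ b ∈ Γ y x, |σ y x b * W b| := Finset.abs_sum_le_sum_abs _ _
    _ ≤ ∑ b ∈ Γ y x, 1 * ω := Finset.sum_le_sum fun b hb => by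
        rw [abs_mul]; exact mul_le_mul (hσ b hb) (hW b) (abs_nonneg _) zero_le_one
    _ = (Γ y x).card * ω := by rw [Finset.sum_const, nsmul_eq_mul, one_mul]
    _ ≤ NΓ * ω := mul_le_mul_of_nonneg_right hΓ hω

variable [Fintype Bd]

/-- **`|A′(y,x)| ≤ e_kη·N_Γ·(e^{−cr(e_k)}S₁a)`** — the `w₁` feed BY NAME: r16's (5.4.7) leaf `Ineq547` for `w₁` (r16 g8
`BIJ88RotationResidual282.abs_sum_mul_le_of_ineq547`: `|(w₁A′)(b)| ≤ e^{−cr(e_k)}S₁a`) inserted in `abs_contourPhase_le`.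
[cite: BalabanImbrieJaffe1988, (5.4.7) p.282] -/
theorem abs_contourPhase_le_of_ineq547 {ekη NΓ c rk S₁ a : ℝ} (hekη : 0 ≤ ekη) (hS₁ : 0 ≤ S₁) (Γ : β → α → Finset Bd)
    (σ : β → α → Bd → ℝ) (w₁ : Bd → Bd → ℝ) (dist : Bd → Bd → ℝ) (A' : Bd → ℝ) (h547 : Ineq547 Bd Bd w₁ dist c rk)
    (hS : ∀ b, ∑ b', Real.exp (-(c * dist b b')) ≤ S₁) (hA : ∀ b', |A' b'| ≤ a) (ha : 0 ≤ a) {y : β} {x : α}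
    (hσ : ∀ b ∈ Γ y x, |σ y x b| ≤ 1) (hΓ : ((Γ y x).card : ℝ) ≤ NΓ) :
    |contourPhase ekη Γ σ (fun b => ∑ b', w₁ b b' * A' b') y x| ≤ ekη * NΓ * (Real.exp (-(c * rk)) * S₁ * a) :=
  abs_contourPhase_le hekη (by positivity) Γ σ _ hσ hΓ
    fun b => BIJ88RotationResidual282.abs_sum_mul_le_of_ineq547 w₁ dist A' h547 (hS b) hA ha

/-- The phase factor `e^{ie_k(w₂A′)(x)}` of *"The scalar fields appear with factors e^{ie_kw₂A′}"* (p. 287), `(w₂A′)(x) = Σ_bw₂(x,b)A′(b)`.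
[cite: BalabanImbrieJaffe1988, (5.4.7) p.282] -/
def phaseFactor {X : Type} (ek : ℝ) (w₂ : X → Bd → ℝ) (A' : Bd → ℝ) (x : X) : ℂ :=
  exp (I * ((ek * ∑ b, w₂ x b * A' b : ℝ) : ℂ))

/-- kernel: `|e^{ie_k(w₂A′)(x)}| = 1`. [cite: BalabanImbrieJaffe1988, (5.4.7) p.282] -/
theorem norm_phaseFactor {X : Type} (ek : ℝ) (w₂ : X → Bd → ℝ) (A' : Bd → ℝ) (x : X) : ‖phaseFactor ek w₂ A' x‖ = 1 := by
  rw [phaseFactor, mul_comm, Complex.norm_exp_ofReal_mul_I]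

/-- **`‖e^{ie_k(w₂A′)(x)} − 1‖ ≤ 2e_k·e^{−cr(e_k)}·S₂·a`** — *"the second term being extremely small"*, from r16's (5.4.7) leaf `Ineq547`
for `w₂` BY NAME (p31 g10 `BIJ88Insertions288.norm_phase_sub_one_le`; lattice sum `Σ_be^{−c dist(x,b)} ≤ S₂`, `|A′| ≤ a`, regime
`e_ke^{−cr}S₂a ≤ 1`). [cite: BalabanImbrieJaffe1988, (5.4.7) p.282] -/
theorem norm_phaseFactor_sub_one_le {X : Type} {ek c rk S₂ a : ℝ} (hek : 0 ≤ ek) (w₂ : X → Bd → ℝ) (dist : X → Bd → ℝ)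
    (A' : Bd → ℝ) (h547 : Ineq547 X Bd w₂ dist c rk) {x : X} (hS : ∑ b, Real.exp (-(c * dist x b)) ≤ S₂)
    (hA : ∀ b, |A' b| ≤ a) (ha : 0 ≤ a) (hsmall : ek * (Real.exp (-(c * rk)) * S₂) * a ≤ 1) :
    ‖phaseFactor ek w₂ A' x - 1‖ ≤ 2 * ek * (Real.exp (-(c * rk)) * S₂) * a :=
  BIJ88Insertions288.norm_phase_sub_one_le hek w₂ dist A' h547 hS hA ha hsmall

end Feeds

/-! ## §2 The complete kinetic site term and its three pieces -/

section Site

variable {α β : Type}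

/-- **The physical kinetic density** `S_phys(y) = κ|ψ̃(y) − (Q(ũ_{k+1}ũ)φ̃)(y)|²` — the left side of (5.6.13) at the `L`-site `y`:
fields with their phase factors (`ψ̃ = ψP_ψ`, `φ̃ = φP_φ`), transporters of `ũ_{k+1}ũ` (`U·e^{iA′}·e^{iA}`, (5.6.6)).
[cite: BalabanImbrieJaffe1988, (5.6.13) p.288] -/
def kinPhys (κ : ℝ) (B : β → Finset α) (w : ℝ) (U : β → α → ℂ) (A A' : β → α → ℝ) (Pψ : β → ℂ) (Pφ : α → ℂ)
    (φ : α → ℂ) (ψ : β → ℂ) (y : β) : ℝ :=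
  κ * ‖ψ y * Pψ y - covAvg B w (twist (twist U A' 1) A 1) (fun x => φ x * Pφ x) y‖ ^ 2

/-- The same density WITHOUT the phase factors, `S_w(y) = κ|ψ(y) − (Q(ũ_{k+1}ũ)φ)(y)|²` (= the `e′ = 1` member of the kinetic
interpolation for the `w₁`-twisted transporters). [cite: BalabanImbrieJaffe1988, (5.6.13) p.288] -/
def kinW (κ : ℝ) (B : β → Finset α) (w : ℝ) (U : β → α → ℂ) (A A' : β → α → ℝ) (φ : α → ℂ) (ψ : β → ℂ) (y : β) : ℝ :=
  kin κ B w (twist U A' 1) A φ ψ y 1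

/-- **The complete kinetic site term `W₁,kin,tot(y)`** of (5.6.13): the bookkeeping `W1` of `BIJ88Eq5613Summary` for the physical density,
the kinetic interpolation family `S_y` of `BIJ88Eq5613Kinetic` and no localization (`δR = 0`). [cite: BalabanImbrieJaffe1988, (5.6.13) p.288] -/
def W1kinTot (κ : ℝ) (B : β → Finset α) (w : ℝ) (U : β → α → ℂ) (A A' : β → α → ℝ) (Pψ : β → ℂ) (Pφ : α → ℂ)
    (φ : α → ℂ) (ψ : β → ℂ) (nbar : ℕ) (y : β) : ℝ :=
  W1 (kinPhys κ B w U A A' Pψ Pφ φ ψ y) (kin κ B w U A φ ψ y) nbar 0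

/-- **(5.6.13), kinetic term, physical left side**: `S_phys(y) = S_y(0) + R̃_y + W₁,kin,tot(y)` (`S_y(0) = κ|ψ(y) − (Q(ũ_{k+1})φ)(y)|²`).
[cite: BalabanImbrieJaffe1988, (5.6.13) p.288] -/
theorem eq5613_kinTot_site (κ : ℝ) (B : β → Finset α) (w : ℝ) (U : β → α → ℂ) (A A' : β → α → ℝ) (Pψ : β → ℂ)
    (Pφ : α → ℂ) (φ : α → ℂ) (ψ : β → ℂ) (nbar : ℕ) (y : β) :
    kinPhys κ B w U A A' Pψ Pφ φ ψ y
      = kin κ B w U A φ ψ y 0 + Rtilde (kin κ B w U A φ ψ y) nbar + W1kinTot κ B w U A A' Pψ Pφ φ ψ nbar y := by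
  have h := eq5613 (kinPhys κ B w U A A' Pψ Pφ φ ψ y) (kin κ B w U A φ ψ y) nbar 0
  rw [sub_zero] at h
  exact h

/-- **The three pieces**: `W₁,kin,tot(y) = (S_phys − S_w) + (S_w − S_y(1)) + W₁,kin(y)` — phase factors, `w₁` terms, order-`> n̄`
remainder (companion `W1_eq_sources` with `δR = 0`). [cite: BalabanImbrieJaffe1988, (5.6.13) p.288] -/
theorem W1kinTot_eq_sources (κ : ℝ) (B : β → Finset α) (w : ℝ) (U : β → α → ℂ) (A A' : β → α → ℝ) (Pψ : β → ℂ)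
    (Pφ : α → ℂ) (φ : α → ℂ) (ψ : β → ℂ) (nbar : ℕ) (y : β) :
    W1kinTot κ B w U A A' Pψ Pφ φ ψ nbar y
      = (kinPhys κ B w U A A' Pψ Pφ φ ψ y - kinW κ B w U A A' φ ψ y)
        + (kinW κ B w U A A' φ ψ y - kin κ B w U A φ ψ y 1) + W1kin κ B w U A φ ψ nbar y := by
  rw [W1kinTot, W1_eq_sources _ (kinW κ B w U A A' φ ψ y), add_zero]
  rfl

/-- kernel: the `w₁`-twisted, `A`-twisted transporters are still unit: `‖U(y,x)e^{iA′}e^{iA}‖ ≤ 1`.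
[cite: BalabanImbrieJaffe1988, (5.6.6) p.287] -/
theorem norm_twist_twist_le {U : β → α → ℂ} {A A' : β → α → ℝ} {y : β} {x : α} (hU : ‖U y x‖ ≤ 1) :
    ‖twist (twist U A' 1) A 1 y x‖ ≤ 1 := by
  simp only [twist, norm_mul, norm_ephase, mul_one]
  exact hU

/-- **The bound of the complete kinetic site term**: with unit transporters, `|A(y,x)| ≤ G`, phase factors `|P − 1| ≤ δ` (on `ψ(y)` and
on `φ` over `B(y)`), `w₁`-phases `|A′(y,x)| ≤ δ′` (`δ′ ≥ 0`):
`|W₁,kin,tot(y)| ≤ |κ|δ(2+δ)ρ₀² + |κ|δ′ρ₁(2ρ₀ + δ′ρ₁) + |κ|(2G)^{n̄+1}ρ₁ρ₀/n̄!` (`ρ₁ = |w|Σ‖φ‖`, `ρ₀ = ‖ψ(y)‖ + ρ₁`).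
[cite: BalabanImbrieJaffe1988, (5.6.13) p.288] -/
theorem abs_W1kinTot_le (κ : ℝ) {B : β → Finset α} {w : ℝ} {U : β → α → ℂ} {A A' : β → α → ℝ} {Pψ : β → ℂ} {Pφ : α → ℂ}
    {φ : α → ℂ} {ψ : β → ℂ} {G δ δ' : ℝ} (hG : 0 ≤ G) (hδ' : 0 ≤ δ') {y : β} (hU : ∀ x ∈ B y, ‖U y x‖ ≤ 1)
    (hA : ∀ x ∈ B y, |A y x| ≤ G) (hPψ : ‖Pψ y - 1‖ ≤ δ) (hPφ : ∀ x ∈ B y, ‖Pφ x - 1‖ ≤ δ)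
    (hA' : ∀ x ∈ B y, |A' y x| ≤ δ') (nbar : ℕ) :
    |W1kinTot κ B w U A A' Pψ Pφ φ ψ nbar y|
      ≤ |κ| * (δ * (2 + δ) * (‖ψ y‖ + rho1 B w φ y) ^ 2)
        + |κ| * (δ' * rho1 B w φ y * (2 * (‖ψ y‖ + rho1 B w φ y) + δ' * rho1 B w φ y))
        + |κ| * ((2 * G) ^ (nbar + 1) * rho1 B w φ y * (‖ψ y‖ + rho1 B w φ y)) / nbar.factorial := by
  rw [W1kinTot_eq_sources]
  have hU2 : ∀ x ∈ B y, ‖twist (twist U A' 1) A 1 y x‖ ≤ 1 := fun x hx => norm_twist_twist_le (hU x hx)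
  have h1 : |kinPhys κ B w U A A' Pψ Pφ φ ψ y - kinW κ B w U A A' φ ψ y|
      ≤ |κ| * (δ * (2 + δ) * (‖ψ y‖ + rho1 B w φ y) ^ 2) := by
    have h := abs_kin_phase_sub_le (B := B) (w := w) (φ := φ) (ψ := ψ) κ hU2 hPψ hPφ
    have hw : kinW κ B w U A A' φ ψ y = κ * ‖ψ y - covAvg B w (twist (twist U A' 1) A 1) φ y‖ ^ 2 := by
      rw [kinW, kin, resid]
    rw [kinPhys, hw]
    exact h
  have h2 : |kinW κ B w U A A' φ ψ y - kin κ B w U A φ ψ y 1|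
      ≤ |κ| * (δ' * rho1 B w φ y * (2 * (‖ψ y‖ + rho1 B w φ y) + δ' * rho1 B w φ y)) := by
    rw [kinW]
    exact abs_kin_w1_sub_le κ hδ' hU fun x hx => (norm_ephase_one_sub_one_le _).trans (hA' x hx)
  have h3 := abs_W1kin_le κ hG hU hA nbar (w := w) (φ := φ) (ψ := ψ)
  calc |kinPhys κ B w U A A' Pψ Pφ φ ψ y - kinW κ B w U A A' φ ψ y
        + (kinW κ B w U A A' φ ψ y - kin κ B w U A φ ψ y 1) + W1kin κ B w U A φ ψ nbar y|
      ≤ |kinPhys κ B w U A A' Pψ Pφ φ ψ y - kinW κ B w U A A' φ ψ y|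
        + |kinW κ B w U A A' φ ψ y - kin κ B w U A φ ψ y 1| + |W1kin κ B w U A φ ψ nbar y| :=
        (abs_add_le _ _).trans (add_le_add (abs_add_le _ _) le_rfl)
    _ ≤ _ := add_le_add (add_le_add h1 h2) h3

end Site

/-! ## §3 Print's currency and the leaf `Ineq5613` for the complete kinetic cube term -/

section Scale

variable {α β : Type}
variable {κ : ℝ} {B : β → Finset α} {w : ℝ} {U : β → α → ℂ} {A A' : β → α → ℝ} {Pψ : β → ℂ} {Pφ : α → ℂ} {φ : α → ℂ}
  {ψ : β → ℂ}

/-- The constant of the complete kinetic bound: the Taylor constant `kinConst` of the companion plus the two source constants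
`6|κ|S₂c_a(c_Ψ + c_Φ)²` (phase factors) and `3|κ|c_ΓS₁c_ac_Φ(c_Ψ + c_Φ)` (`w₁`). [cite: BalabanImbrieJaffe1988, (5.6.13) p.288] -/
def kinTotConst (κ cG cΦ cΨ S₁ S₂ ca cΓ : ℝ) (nbar : ℕ) : ℝ :=
  kinConst κ cG cΦ cΨ nbar + 6 * |κ| * S₂ * ca * (cΨ + cΦ) ^ 2 + 3 * |κ| * cΓ * S₁ * ca * cΦ * (cΨ + cΦ)

/-- kernel: `K ≥ 0`. [cite: BalabanImbrieJaffe1988, (5.6.13) p.288] -/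
theorem kinTotConst_nonneg {κ cG cΦ cΨ S₁ S₂ ca cΓ : ℝ} (hG : 0 ≤ cG) (hΦ : 0 ≤ cΦ) (hΨ : 0 ≤ cΨ) (hS₁ : 0 ≤ S₁)
    (hS₂ : 0 ≤ S₂) (hca : 0 ≤ ca) (hcΓ : 0 ≤ cΓ) (nbar : ℕ) : 0 ≤ kinTotConst κ cG cΦ cΨ S₁ S₂ ca cΓ nbar := by
  unfold kinTotConst
  have := kinConst_nonneg (κ := κ) hG hΦ hΨ nbar
  positivity
set_option maxHeartbeats 400000 in
/-- **The complete kinetic site bound in print's currency.**  Inputs: the companion's `G ≤ c_Ge·p`, `eΦ ≤ c_Φp`, `eΨ ≤ c_Ψp`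
(`e = e_k`, `p = p(e_k)`), the (5.4.7) sizes `δ ≤ 2e·E·S₂·a` (phase factors, `norm_phaseFactor_sub_one_le`) and `δ′ ≤ c_Γe·E·S₁·a` (`w₁`,
`abs_contourPhase_le` with `e_kηN_Γ ≤ c_Γe_k`), `E = e^{−cr(e_k)}`, `a = c_ap` (`|A′| ≦ cp(e_k)`), regime `δ ≤ 1`, `δ′ ≤ 1`, and the
conversion `E ≤ e^{n̄}` of the companion's `exp_neg_mul_rLen_le_rpow`: then `|W₁,kin,tot(y)| ≤ K·e^{n̄−1}·p^{n̄+3}` (`p ≥ 1`).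
[cite: BalabanImbrieJaffe1988, (5.6.13) p.288] -/
theorem abs_W1kinTot_le_scale {e p cG cΦ cΨ S₁ S₂ ca cΓ G Φ Ψ δ δ' E : ℝ} {nbar : ℕ} (he : 0 < e) (hp1 : 1 ≤ pLog p e)
    (hcG : 0 ≤ cG) (hcΦ : 0 ≤ cΦ) (hcΨ : 0 ≤ cΨ) (hS₁ : 0 ≤ S₁) (hS₂ : 0 ≤ S₂) (hca : 0 ≤ ca) (hcΓ : 0 ≤ cΓ) (hG0 : 0 ≤ G)
    (hΦ0 : 0 ≤ Φ) (hδ0 : 0 ≤ δ) (hδ1 : δ ≤ 1) (hδ'0 : 0 ≤ δ') (hδ'1 : δ' ≤ 1) (hE0 : 0 ≤ E) (hEe : E ≤ e ^ (nbar : ℝ))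
    (hG : G ≤ cG * e * pLog p e) (hΦ : e * Φ ≤ cΦ * pLog p e) (hΨ : e * Ψ ≤ cΨ * pLog p e)
    (hδ : δ ≤ 2 * e * E * S₂ * (ca * pLog p e)) (hδ' : δ' ≤ cΓ * e * E * S₁ * (ca * pLog p e))
    {y : β} (hU : ∀ x ∈ B y, ‖U y x‖ ≤ 1) (hA : ∀ x ∈ B y, |A y x| ≤ G) (hPψ : ‖Pψ y - 1‖ ≤ δ)
    (hPφ : ∀ x ∈ B y, ‖Pφ x - 1‖ ≤ δ) (hA' : ∀ x ∈ B y, |A' y x| ≤ δ') (hφ : ∀ x ∈ B y, ‖φ x‖ ≤ Φ) (hψ : ‖ψ y‖ ≤ Ψ)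
    (hw : |w| * (B y).card ≤ 1) :
    |W1kinTot κ B w U A A' Pψ Pφ φ ψ nbar y|
      ≤ kinTotConst κ cG cΦ cΨ S₁ S₂ ca cΓ nbar * e ^ ((nbar : ℝ) - 1) * pLog p e ^ (nbar + 3) := by
  have _ := hE0
  set P := pLog p e with hPdef
  have hP : 0 ≤ P := zero_le_one.trans hp1
  have hρ1 : rho1 B w φ y ≤ Φ := rho1_le_of_fieldBound B w φ y hΦ0 hφ hw
  have hρ1' : 0 ≤ rho1 B w φ y := rho1_nonneg B w φ y
  set ρ₀ := ‖ψ y‖ + rho1 B w φ y with hρ₀def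
  have hρ₀ : ρ₀ ≤ Ψ + Φ := add_le_add hψ hρ1
  have hρ₀' : 0 ≤ ρ₀ := add_nonneg (norm_nonneg _) hρ1'
  have hΨ0 : 0 ≤ Ψ := (norm_nonneg _).trans hψ
  -- field bounds in currency: `Φ ≤ c_ΦP/e`, `Ψ + Φ ≤ (c_Ψ + c_Φ)P/e`
  have hΦ' : Φ ≤ cΦ * P / e := by rw [le_div_iff₀ he]; linarith
  have hΨΦ : Ψ + Φ ≤ (cΨ + cΦ) * P / e := by rw [le_div_iff₀ he]; linarith
  have hcur := abs_W1kinTot_le κ hG0 hδ'0 hU hA hPψ hPφ hA' nbar (w := w) (φ := φ) (ψ := ψ)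
  -- the main power: `e^{n̄+1}/e² = e^{n̄−1}`, `E/e ≤ e^{n̄−1}`
  have hpow1 : e ^ (nbar + 1) / e / e = e ^ ((nbar : ℝ) - 1) := by
    rw [div_div, ← pow_two, ← Real.rpow_natCast, ← Real.rpow_natCast, ← Real.rpow_sub he]; push_cast; ring_nf
  have hpow2 : E / e ≤ e ^ ((nbar : ℝ) - 1) := by
    rw [div_le_iff₀ he, Real.rpow_sub he, Real.rpow_one, div_mul_cancel₀ _ he.ne']; exact hEe
  have henn : 0 ≤ e ^ ((nbar : ℝ) - 1) := Real.rpow_nonneg he.le _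
  -- (1) phase-factor piece: `|κ|δ(2+δ)ρ₀² ≤ 3|κ|δρ₀² ≤ 6|κ|S₂c_a(c_Ψ+c_Φ)² · (E/e) · P³`
  have h1 : |κ| * (δ * (2 + δ) * ρ₀ ^ 2) ≤ 6 * |κ| * S₂ * ca * (cΨ + cΦ) ^ 2 * e ^ ((nbar : ℝ) - 1) * P ^ (nbar + 3) := by
    have hρ₀sq : ρ₀ ^ 2 ≤ ((cΨ + cΦ) * P / e) ^ 2 := pow_le_pow_left₀ hρ₀' (hρ₀.trans hΨΦ) 2
    have hP3 : P ^ 3 ≤ P ^ (nbar + 3) := pow_le_pow_right₀ hp1 (by omega)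
    calc |κ| * (δ * (2 + δ) * ρ₀ ^ 2) ≤ |κ| * ((2 * e * E * S₂ * (ca * P)) * 3 * ((cΨ + cΦ) * P / e) ^ 2) := by
          refine mul_le_mul_of_nonneg_left ?_ (abs_nonneg κ)
          have : δ * (2 + δ) ≤ (2 * e * E * S₂ * (ca * P)) * 3 :=
            calc δ * (2 + δ) ≤ δ * 3 := mul_le_mul_of_nonneg_left (by linarith) hδ0
              _ ≤ (2 * e * E * S₂ * (ca * P)) * 3 := mul_le_mul_of_nonneg_right hδ (by norm_num)
          exact mul_le_mul this hρ₀sq (sq_nonneg _) (by positivity)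
      _ = 6 * |κ| * S₂ * ca * (cΨ + cΦ) ^ 2 * (E / e) * P ^ 3 := by field_simp; ring
      _ ≤ 6 * |κ| * S₂ * ca * (cΨ + cΦ) ^ 2 * e ^ ((nbar : ℝ) - 1) * P ^ (nbar + 3) := by
          have hc : 0 ≤ 6 * |κ| * S₂ * ca * (cΨ + cΦ) ^ 2 := by positivity
          calc 6 * |κ| * S₂ * ca * (cΨ + cΦ) ^ 2 * (E / e) * P ^ 3
              ≤ 6 * |κ| * S₂ * ca * (cΨ + cΦ) ^ 2 * e ^ ((nbar : ℝ) - 1) * P ^ 3 := by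
                exact mul_le_mul_of_nonneg_right (mul_le_mul_of_nonneg_left hpow2 hc) (pow_nonneg hP 3)
            _ ≤ _ := mul_le_mul_of_nonneg_left hP3 (mul_nonneg hc henn)
  -- (2) w₁ piece: `|κ|δ′ρ₁(2ρ₀ + δ′ρ₁) ≤ 3|κ|δ′Φ(Ψ+Φ) ≤ 3|κ|c_ΓS₁c_ac_Φ(c_Ψ+c_Φ)·(E/e)·P³`
  have h2 : |κ| * (δ' * rho1 B w φ y * (2 * ρ₀ + δ' * rho1 B w φ y))
      ≤ 3 * |κ| * cΓ * S₁ * ca * cΦ * (cΨ + cΦ) * e ^ ((nbar : ℝ) - 1) * P ^ (nbar + 3) := by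
    have hin : 2 * ρ₀ + δ' * rho1 B w φ y ≤ 3 * ((cΨ + cΦ) * P / e) := by
      have : δ' * rho1 B w φ y ≤ 1 * (Ψ + Φ) := mul_le_mul hδ'1 (hρ1.trans (by linarith)) hρ1' zero_le_one
      linarith
    have hP3 : P ^ 3 ≤ P ^ (nbar + 3) := pow_le_pow_right₀ hp1 (by omega)
    calc |κ| * (δ' * rho1 B w φ y * (2 * ρ₀ + δ' * rho1 B w φ y))
        ≤ |κ| * ((cΓ * e * E * S₁ * (ca * P)) * (cΦ * P / e) * (3 * ((cΨ + cΦ) * P / e))) := by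
          refine mul_le_mul_of_nonneg_left ?_ (abs_nonneg κ)
          exact mul_le_mul (mul_le_mul hδ' (hρ1.trans hΦ') hρ1' (by positivity)) hin (by positivity) (by positivity)
      _ = 3 * |κ| * cΓ * S₁ * ca * cΦ * (cΨ + cΦ) * (E / e) * P ^ 3 := by field_simp
      _ ≤ 3 * |κ| * cΓ * S₁ * ca * cΦ * (cΨ + cΦ) * e ^ ((nbar : ℝ) - 1) * P ^ (nbar + 3) := by
          have hc : 0 ≤ 3 * |κ| * cΓ * S₁ * ca * cΦ * (cΨ + cΦ) := by positivity
          calc 3 * |κ| * cΓ * S₁ * ca * cΦ * (cΨ + cΦ) * (E / e) * P ^ 3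
              ≤ 3 * |κ| * cΓ * S₁ * ca * cΦ * (cΨ + cΦ) * e ^ ((nbar : ℝ) - 1) * P ^ 3 :=
                mul_le_mul_of_nonneg_right (mul_le_mul_of_nonneg_left hpow2 hc) (pow_nonneg hP 3)
            _ ≤ _ := mul_le_mul_of_nonneg_left hP3 (mul_nonneg hc henn)
  -- (3) Taylor piece: as in the companion's `abs_W1kin_le_scale`
  have h3 : |κ| * ((2 * G) ^ (nbar + 1) * rho1 B w φ y * ρ₀) / nbar.factorial
      ≤ kinConst κ cG cΦ cΨ nbar * e ^ ((nbar : ℝ) - 1) * P ^ (nbar + 3) := by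
    have h2G : 2 * G ≤ 2 * cG * e * P := by linarith
    have hpow : (2 * G) ^ (nbar + 1) ≤ (2 * cG * e * P) ^ (nbar + 1) := pow_le_pow_left₀ (by positivity) h2G _
    calc |κ| * ((2 * G) ^ (nbar + 1) * rho1 B w φ y * ρ₀) / nbar.factorial
        ≤ |κ| * ((2 * cG * e * P) ^ (nbar + 1) * (cΦ * P / e) * ((cΨ + cΦ) * P / e)) / nbar.factorial := by
          refine div_le_div_of_nonneg_right (mul_le_mul_of_nonneg_left ?_ (abs_nonneg κ)) (Nat.cast_nonneg _)
          exact mul_le_mul (mul_le_mul hpow (hρ1.trans hΦ') hρ1' (by positivity)) (hρ₀.trans hΨΦ) hρ₀' (by positivity)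
      _ = kinConst κ cG cΦ cΨ nbar * (e ^ (nbar + 1) / e / e) * P ^ (nbar + 3) := by
          unfold kinConst; field_simp; ring
      _ = kinConst κ cG cΦ cΨ nbar * e ^ ((nbar : ℝ) - 1) * P ^ (nbar + 3) := by rw [hpow1]
  calc |W1kinTot κ B w U A A' Pψ Pφ φ ψ nbar y| ≤ _ := hcur
    _ ≤ 6 * |κ| * S₂ * ca * (cΨ + cΦ) ^ 2 * e ^ ((nbar : ℝ) - 1) * P ^ (nbar + 3)
        + 3 * |κ| * cΓ * S₁ * ca * cΦ * (cΨ + cΦ) * e ^ ((nbar : ℝ) - 1) * P ^ (nbar + 3)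
        + kinConst κ cG cΦ cΨ nbar * e ^ ((nbar : ℝ) - 1) * P ^ (nbar + 3) := add_le_add (add_le_add h1 h2) h3
    _ = kinTotConst κ cG cΦ cΨ S₁ S₂ ca cΓ nbar * e ^ ((nbar : ℝ) - 1) * P ^ (nbar + 3) := by
        unfold kinTotConst; ring

variable {γ : Type*} [DecidableEq γ]

/-- **`W₁,kin,tot(□) = Σ_{y∈□}W₁,kin,tot(y)`** (companion `cubeSum`). [cite: BalabanImbrieJaffe1988, (5.6.13) p.288] -/
def W1kinTotCube (κ : ℝ) (B : β → Finset α) (w : ℝ) (U : β → α → ℂ) (A A' : β → α → ℝ) (Pψ : β → ℂ) (Pφ : α → ℂ)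
    (φ : α → ℂ) (ψ : β → ℂ) (nbar : ℕ) (Y : Finset β) (cube : β → γ) (c : γ) : ℝ :=
  cubeSum Y cube (W1kinTot κ B w U A A' Pψ Pφ φ ψ nbar) c

/-- **The kinetic line of (5.6.13) with the PHYSICAL left side**: `Σ_y S_phys(y) = Σ_y S_y(0) + Σ_y R̃_y + Σ_□ W₁,kin,tot(□)`.
[cite: BalabanImbrieJaffe1988, (5.6.13) p.288] -/
theorem eq5613_kinTot (κ : ℝ) (B : β → Finset α) (w : ℝ) (U : β → α → ℂ) (A A' : β → α → ℝ) (Pψ : β → ℂ) (Pφ : α → ℂ)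
    (φ : α → ℂ) (ψ : β → ℂ) (nbar : ℕ) (Y : Finset β) (cube : β → γ) :
    ∑ y ∈ Y, kinPhys κ B w U A A' Pψ Pφ φ ψ y
      = ∑ y ∈ Y, kin κ B w U A φ ψ y 0 + ∑ y ∈ Y, Rtilde (kin κ B w U A φ ψ y) nbar
        + ∑ c ∈ Y.image cube, W1kinTotCube κ B w U A A' Pψ Pφ φ ψ nbar Y cube c := by
  unfold W1kinTotCube
  rw [← sum_eq_sum_cubeSum, ← Finset.sum_add_distrib, ← Finset.sum_add_distrib]
  exact Finset.sum_congr rfl fun y _ => eq5613_kinTot_site κ B w U A A' Pψ Pφ φ ψ nbar y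

/-- **The complete kinetic cube bound in print's currency**: site bound × `|□| ≤ r(e)^d` sites, all logarithms collected:
`|W₁,kin,tot(□)| ≤ K·e^{n̄−1}·(log e⁻¹)^{p(n̄+3)+rd}` (`e ≤ e⁻¹`, `0 ≤ p`). [cite: BalabanImbrieJaffe1988, (5.6.13) p.288] -/
theorem abs_W1kinTotCube_le_scale {e p r cG cΦ cΨ S₁ S₂ ca cΓ G Φ Ψ δ δ' E : ℝ} {d : ℕ} (he : 0 < e)
    (he1 : e ≤ Real.exp (-1)) (hp : 0 ≤ p) (hcG : 0 ≤ cG) (hcΦ : 0 ≤ cΦ) (hcΨ : 0 ≤ cΨ) (hS₁ : 0 ≤ S₁) (hS₂ : 0 ≤ S₂)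
    (hca : 0 ≤ ca) (hcΓ : 0 ≤ cΓ) (hG0 : 0 ≤ G) (hΦ0 : 0 ≤ Φ) (hδ0 : 0 ≤ δ) (hδ1 : δ ≤ 1) (hδ'0 : 0 ≤ δ') (hδ'1 : δ' ≤ 1)
    (hE0 : 0 ≤ E) {nbar : ℕ} (hEe : E ≤ e ^ (nbar : ℝ)) (hG : G ≤ cG * e * pLog p e) (hΦ : e * Φ ≤ cΦ * pLog p e)
    (hΨ : e * Ψ ≤ cΨ * pLog p e) (hδ : δ ≤ 2 * e * E * S₂ * (ca * pLog p e)) (hδ' : δ' ≤ cΓ * e * E * S₁ * (ca * pLog p e))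
    (Y : Finset β) (cube : β → γ) (c : γ) (hU : ∀ y ∈ Y, ∀ x ∈ B y, ‖U y x‖ ≤ 1) (hA : ∀ y ∈ Y, ∀ x ∈ B y, |A y x| ≤ G)
    (hPψ : ∀ y ∈ Y, ‖Pψ y - 1‖ ≤ δ) (hPφ : ∀ y ∈ Y, ∀ x ∈ B y, ‖Pφ x - 1‖ ≤ δ) (hA' : ∀ y ∈ Y, ∀ x ∈ B y, |A' y x| ≤ δ')
    (hφ : ∀ y ∈ Y, ∀ x ∈ B y, ‖φ x‖ ≤ Φ) (hψ : ∀ y ∈ Y, ‖ψ y‖ ≤ Ψ) (hw : ∀ y ∈ Y, |w| * (B y).card ≤ 1)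
    (hcard : ((Y.filter (fun y => cube y = c)).card : ℝ) ≤ rLen r e ^ d) :
    |W1kinTotCube κ B w U A A' Pψ Pφ φ ψ nbar Y cube c|
      ≤ kinTotConst κ cG cΦ cΨ S₁ S₂ ca cΓ nbar * e ^ ((nbar : ℝ) - 1) * Real.log e⁻¹ ^ kinLogPower p r d nbar := by
  have he1' : e ≤ 1 := le_one_of_le_exp_neg_one he1
  have hp1 : 1 ≤ pLog p e := by
    rw [pLog_eq_rpow he he1']
    exact Real.one_le_rpow (one_le_log_inv he he1) hp
  have hK := kinTotConst_nonneg (κ := κ) hcG hcΦ hcΨ hS₁ hS₂ hca hcΓ nbar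
  have hsite : ∀ y ∈ Y, cube y = c → |W1kinTot κ B w U A A' Pψ Pφ φ ψ nbar y|
      ≤ kinTotConst κ cG cΦ cΨ S₁ S₂ ca cΓ nbar * e ^ ((nbar : ℝ) - 1) * pLog p e ^ (nbar + 3) :=
    fun y hy _ => abs_W1kinTot_le_scale he hp1 hcG hcΦ hcΨ hS₁ hS₂ hca hcΓ hG0 hΦ0 hδ0 hδ1 hδ'0 hδ'1 hE0 hEe hG hΦ hΨ hδ hδ'
      (hU y hy) (hA y hy) (hPψ y hy) (hPφ y hy) (hA' y hy) (hφ y hy) (hψ y hy) (hw y hy)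
  have h := norm_cubeSum_le Y cube (W1kinTot κ B w U A A' Pψ Pφ φ ψ nbar) c (b := _) (fun y hy hc => by
    rw [Real.norm_eq_abs]; exact hsite y hy hc)
  rw [Real.norm_eq_abs] at h
  refine h.trans ?_
  have hb : 0 ≤ kinTotConst κ cG cΦ cΨ S₁ S₂ ca cΓ nbar * e ^ ((nbar : ℝ) - 1) * pLog p e ^ (nbar + 3) :=
    mul_nonneg (mul_nonneg hK (Real.rpow_nonneg he.le _)) (pow_nonneg (Real.rpow_nonneg (abs_nonneg _) _) _)
  calc ((Y.filter (fun y => cube y = c)).card : ℝ) * (kinTotConst κ cG cΦ cΨ S₁ S₂ ca cΓ nbar * e ^ ((nbar : ℝ) - 1) *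
        pLog p e ^ (nbar + 3))
      ≤ rLen r e ^ d * (kinTotConst κ cG cΦ cΨ S₁ S₂ ca cΓ nbar * e ^ ((nbar : ℝ) - 1) * pLog p e ^ (nbar + 3)) :=
        mul_le_mul_of_nonneg_right hcard hb
    _ = kinTotConst κ cG cΦ cΨ S₁ S₂ ca cΓ nbar * e ^ ((nbar : ℝ) - 1) * (pLog p e ^ (nbar + 3) * rLen r e ^ d) := by ring
    _ = kinTotConst κ cG cΦ cΨ S₁ S₂ ca cΓ nbar * e ^ ((nbar : ℝ) - 1) * Real.log e⁻¹ ^ kinLogPower p r d nbar := by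
        congr 1
        rw [pLog_eq_rpow he he1', rLen_eq_rpow he he1', log_rpow_pow he he1', log_rpow_pow he he1',
          log_rpow_mul_log_rpow he he1, kinLogPower]
        push_cast; ring_nf

/-- **`|W₁^{(k)}(□)| ≦ e_k^{n̄−1−α}` for the COMPLETE kinetic cube term** — r16's leaf `Ineq5613` INHABITED by `W₁ = W₁,kin,tot(□)` with
the `w₁`/`w₂` sources in the sizes fed from (5.4.7): `0 < e_k ≤ min(e⁻¹, e₀)` (`e₀ = threshold K q α`), the (5.4.7) exponential
`E = e^{−cr(e_k)}` below `e_k^{n̄}` — which `BIJ88Eq5613Summary.exp_neg_mul_rLen_le_rpow` grants once `(log e_k⁻¹)^{r−1} ≥ n̄/c`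
(hypothesis `hbig`, `r > 1` as in (2.3)). [cite: BalabanImbrieJaffe1988, (5.6.13) p.288] -/
theorem ineq5613_kinTot {γ : Type} [DecidableEq γ] {e p r cr cG cΦ cΨ S₁ S₂ ca cΓ G Φ Ψ δ δ' α' : ℝ} {d : ℕ} (he : 0 < e)
    (he1 : e ≤ Real.exp (-1)) (hp : 0 ≤ p) (hr : 1 < r) (hcr : 0 < cr) (hcG : 0 ≤ cG) (hcΦ : 0 ≤ cΦ) (hcΨ : 0 ≤ cΨ)
    (hS₁ : 0 ≤ S₁) (hS₂ : 0 ≤ S₂) (hca : 0 ≤ ca) (hcΓ : 0 ≤ cΓ) (hG0 : 0 ≤ G) (hΦ0 : 0 ≤ Φ) (hδ0 : 0 ≤ δ) (hδ1 : δ ≤ 1)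
    (hδ'0 : 0 ≤ δ') (hδ'1 : δ' ≤ 1) {nbar : ℕ} (hbig : (nbar : ℝ) / cr ≤ Real.log e⁻¹ ^ (r - 1))
    (hG : G ≤ cG * e * pLog p e) (hΦ : e * Φ ≤ cΦ * pLog p e) (hΨ : e * Ψ ≤ cΨ * pLog p e)
    (hδ : δ ≤ 2 * e * Real.exp (-(cr * rLen r e)) * S₂ * (ca * pLog p e))
    (hδ' : δ' ≤ cΓ * e * Real.exp (-(cr * rLen r e)) * S₁ * (ca * pLog p e))
    (Y : Finset β) (cube : β → γ) (hU : ∀ y ∈ Y, ∀ x ∈ B y, ‖U y x‖ ≤ 1) (hA : ∀ y ∈ Y, ∀ x ∈ B y, |A y x| ≤ G)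
    (hPψ : ∀ y ∈ Y, ‖Pψ y - 1‖ ≤ δ) (hPφ : ∀ y ∈ Y, ∀ x ∈ B y, ‖Pφ x - 1‖ ≤ δ) (hA' : ∀ y ∈ Y, ∀ x ∈ B y, |A' y x| ≤ δ')
    (hφ : ∀ y ∈ Y, ∀ x ∈ B y, ‖φ x‖ ≤ Φ) (hψ : ∀ y ∈ Y, ‖ψ y‖ ≤ Ψ) (hw : ∀ y ∈ Y, |w| * (B y).card ≤ 1)
    (hcard : ∀ c, ((Y.filter (fun y => cube y = c)).card : ℝ) ≤ rLen r e ^ d) (hα : 0 < α')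
    (hq : 0 < kinLogPower p r d nbar)
    (hth : e ≤ threshold (kinTotConst κ cG cΦ cΨ S₁ S₂ ca cΓ nbar) (kinLogPower p r d nbar) α') :
    Ineq5613 γ (W1kinTotCube κ B w U A A' Pψ Pφ φ ψ nbar Y cube) e nbar α' := by
  have he1' : e ≤ 1 := le_one_of_le_exp_neg_one he1
  have hEe : Real.exp (-(cr * rLen r e)) ≤ e ^ (nbar : ℝ) := exp_neg_mul_rLen_le_rpow hcr hr he he1' hbig
  refine ineq5613_of_cube_bounds Y cube _ he nbar α' fun c _ => ?_
  exact BIJ88Eq5613Summary.absorb_logs_nbar (kinTotConst_nonneg hcG hcΦ hcΨ hS₁ hS₂ hca hcΓ nbar) hq hα he he1' hth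
    (abs_W1kinTotCube_le_scale he he1 hp hcG hcΦ hcΨ hS₁ hS₂ hca hcΓ hG0 hΦ0 hδ0 hδ1 hδ'0 hδ'1 (Real.exp_pos _).le hEe hG hΦ hΨ
      hδ hδ' Y cube c hU hA hPψ hPφ hA' hφ hψ hw (hcard c))

end Scale

end Literature.MathematicalPhysics.QuantumFieldTheory.BalabanImbrieJaffe1984to88.BIJ88Eq5613KineticSources

end
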